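import Summits.CriticalPhenomena.SAWScalingLimit.Theorems.SAWLoopFugacityFlowIsingBoundaryRatioWindowRectPolygonWinding
import HarnessLib

/-!
# One boundary cycle: the successor orbit of a connected hole-free discrete domain covers all external darts
(line `fk-anchor-transfer`, crux `IsingBoundaryRatio`, stmt-CriticalPhenomena-10650; helper file of the stub
`windowRectPresentation_holds`)

**Theorem** (`exists_iterate_succ_eq_of_escape`, the `cover` field of `DiscreteRect.IsRect`). Let `E` be a
finite set of lattice edges which is CONNECTED (any two vertices are joined through edges of `E`) and
HOLE-FREE in the combinatorial sense: from every unit square with a side not in `E` one can walk to squares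
arbitrarily high up through consecutive side-adjacent squares, each time across a side that is not in `E`
(CDH16 §2.1: "all edges surrounded by a cycle from `𝓔(G)` also belong to `𝓔(G)`"). Then the boundary-tracing
orbit of any external dart `d₀` (period `N`, `DiscreteRect.succ`) passes through EVERY external dart.

Proof (winding numbers, no Jordan curve theorem). Draw the orbit as the offset boundary polygon `Γ`
(`…WindowRectGeomDefs`, here with `δ = 1`, `η = 1/4`). By `…WindowRectPolygonWinding` the winding number
of `Γ` drops by one from the inner to the outer test point of the bud of `d₀`, and does not change across the
bud of an external dart `d` off the orbit. But the inner test points of `d` and `d₀` are joined off `Γ`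
through the open squares about the lattice points and along the edges of `E` (connectedness;
`…WindowRectPolygonAvoid`), and the outer test points are joined off `Γ` through the centres of exterior
squares (hole-freeness) and far above all vertices; winding numbers are constant along such paths
(`wind_sub_eq_of_mem_connectedComponentIn`) — contradiction. [folklore]
-/

noncomputable section

open scoped Classical Real
open Set Complex Literature.Probability.LatticeModels Literature.Probability.LatticeModels.DiscreteRect
open Literature.Topology.PlaneTopology

namespace Summit.CriticalPhenomena.SAWScalingLimit.Theorems.IsingBoundaryRatio

namespace WindowRect

variable {δ η : ℝ} {E : Finset (Sym2 (Site 2))}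

/-! ### Segments off the polygon -/

/-- Frame points are affine in both coordinates. [folklore] -/
theorem framePt_lineMap (δ : ℝ) (a : Site 2 × Fin 4) (t₀ s₀ t₁ s₁ θ : ℝ) :
    AffineMap.lineMap (framePt δ a t₀ s₀) (framePt δ a t₁ s₁) θ =
      framePt δ a ((1 - θ) * t₀ + θ * t₁) ((1 - θ) * s₀ + θ * s₁) := by
  rw [AffineMap.lineMap_apply_module]
  simp only [framePt]
  apply Complex.ext <;> simp [meshPoint] <;> ring

/-- A point of a segment between two frame points of one frame. [folklore] -/
theorem exists_of_mem_segment_framePt {a : Site 2 × Fin 4} {t₀ s₀ t₁ s₁ : ℝ} {z : ℂ}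
    (hz : z ∈ segment ℝ (framePt δ a t₀ s₀) (framePt δ a t₁ s₁)) :
    ∃ θ ∈ Icc (0 : ℝ) 1, z = framePt δ a ((1 - θ) * t₀ + θ * t₁) ((1 - θ) * s₀ + θ * s₁) := by
  rw [segment_eq_image_lineMap] at hz
  obtain ⟨θ, hθ, rfl⟩ := hz
  exact ⟨θ, hθ, framePt_lineMap δ a t₀ s₀ t₁ s₁ θ⟩

/-- A value between two bounds (convex combination). [folklore] -/
theorem convexComb_mem_Icc {θ a b lo hi : ℝ} (hθ : θ ∈ Icc (0 : ℝ) 1) (ha : a ∈ Icc lo hi) (hb : b ∈ Icc lo hi) :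
    (1 - θ) * a + θ * b ∈ Icc lo hi := by
  obtain ⟨h0, h1⟩ := hθ
  constructor <;> nlinarith [ha.1, ha.2, hb.1, hb.2]

/-- The polygon points are side points of EXTERNAL darts or connector points (packaging of
`range_arcPath_subset` with `IsExtDart.iterate`). [folklore] -/
theorem side_or_conn_of_mem_range (hη : 0 < η) (h2 : 2 * η ≤ δ) {d₀ : Site 2 × Fin 4} (hd₀ : IsExtDart E d₀)
    (m : ℕ) {z : ℂ} (hz : z ∈ range (arcPath E δ η d₀ m)) :
    (∃ v K, IsExtDart E (v, K) ∧ z ∈ segment ℝ (framePt δ (v, K) η (-η)) (framePt δ (v, K) η η)) ∨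
      ∃ a : Site 2 × Fin 4, aedge a ∈ E ∧ ∃ t ∈ Icc η (δ - η), (z = framePt δ a t η ∨ z = framePt δ a t (-η)) := by
  rcases range_arcPath_subset hη h2 d₀ m hz with ⟨i, -, hi⟩ | h
  · refine Or.inl ⟨((succ E)^[i] d₀).1, ((succ E)^[i] d₀).2, ?_, hi⟩
    exact hd₀.iterate i
  · exact Or.inr h

/-- Lattice points in any frame. [folklore] -/
theorem framePt_zero_zero (x : Site 2) (k k' : Fin 4) : framePt δ (x, k) 0 0 = framePt δ (x, k') 0 0 := by
  simp [framePt, meshPoint]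

variable (hδ : 0 < δ) (hη : 0 < η) (h4 : 4 * η ≤ δ) {d₀ : Site 2 × Fin 4} (hd₀ : IsExtDart E d₀) (N : ℕ)
include hδ hη h4 hd₀

/-- **Inside**: the segment from the inner test point of an arrow to its lattice point misses the polygon.
[folklore] -/
theorem joinedIn_testIn_center (x : Site 2) (k : Fin 4) :
    JoinedIn (range (arcPath E δ η d₀ N))ᶜ (framePt δ (x, k) (η - η / 4) (η / 2)) (framePt δ (x, k) 0 0) := by
  refine JoinedIn.of_segment_subset fun z hz hzΓ => ?_
  obtain ⟨θ, hθ, rfl⟩ := exists_of_mem_segment_framePt hz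
  have ha : |(1 - θ) * (η - η / 4) + θ * 0| < η := by
    rw [abs_lt]; constructor <;> nlinarith [hθ.1, hθ.2]
  have hb : |(1 - θ) * (η / 2) + θ * 0| < η := by
    rw [abs_lt]; constructor <;> nlinarith [hθ.1, hθ.2]
  rcases side_or_conn_of_mem_range hη (by linarith) hd₀ N hzΓ with ⟨v, K, -, h⟩ | ⟨a, ha', t, ht, h⟩
  · exact inside_not_side hδ hη h4 ha hb h
  · exact inside_not_conn hδ hη h4 ha hb ha' ht h

/-- **Inside**: the segment of an edge of `E` between its two lattice points misses the polygon.
[folklore] -/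
theorem joinedIn_edge {x : Site 2} {k : Fin 4} (he : aedge (x, k) ∈ E) :
    JoinedIn (range (arcPath E δ η d₀ N))ᶜ (framePt δ (x, k) 0 0) (framePt δ (x + dir k, k + 2) 0 0) := by
  -- through the midpoint
  have hmid : framePt δ (x, k) (δ / 2) 0 = framePt δ (x + dir k, k + 2) (δ / 2) 0 := by
    rw [framePt_reverse x k (δ / 2) 0, neg_zero]; congr 1; ring
  have half : ∀ {y : Site 2} {K : Fin 4}, aedge (y, K) ∈ E →
      JoinedIn (range (arcPath E δ η d₀ N))ᶜ (framePt δ (y, K) 0 0) (framePt δ (y, K) (δ / 2) 0) := by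
    intro y K hye
    refine JoinedIn.of_segment_subset fun z hz hzΓ => ?_
    obtain ⟨s, hs, rfl⟩ := exists_of_mem_segment_fst (by linarith) hz
    rcases side_or_conn_of_mem_range hη (by linarith) hd₀ N hzΓ with ⟨v, K', hext, h⟩ | ⟨a, ha', t, ht, h⟩
    · exact edgeLine_not_side hδ hη h4 hye hs hext h
    · exact edgeLine_not_conn hδ hη h4 hs ha' ht h
  have h1 := half he
  have h2 := half (y := x + dir k) (K := k + 2) (by rw [aedge_reverse]; exact he)
  rw [← hmid] at h2
  exact h1.trans h2.symm

/-- **Inside**: the inner test points of any two arrows at connected vertices are joined off the polygon.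
[folklore] -/
theorem joinedIn_testIn (hE : ∀ e ∈ E, e ∈ (zdGraph 2).edgeSet) {x y : Site 2} (k k' : Fin 4)
    (hxy : Relation.ReflTransGen (fun a b : Site 2 => s(a, b) ∈ E) x y) :
    JoinedIn (range (arcPath E δ η d₀ N))ᶜ (framePt δ (x, k) (η - η / 4) (η / 2))
      (framePt δ (y, k') (η - η / 4) (η / 2)) := by
  have hcent : JoinedIn (range (arcPath E δ η d₀ N))ᶜ (framePt δ (x, k) 0 0) (framePt δ (y, k') 0 0) := by
    induction hxy with
    | refl =>
      rw [framePt_zero_zero x k k']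
      exact JoinedIn.refl (joinedIn_testIn_center hδ hη h4 hd₀ N x k').target_mem
    | @tail b c _ hbc ih =>
      obtain ⟨j, rfl⟩ := exists_eq_add_dir_of_adj (by
        have := hE _ hbc
        rwa [SimpleGraph.mem_edgeSet] at this)
      have hj := joinedIn_edge hδ hη h4 hd₀ N (x := b) (k := j) hbc
      rw [framePt_zero_zero b k' j] at ih
      rw [framePt_zero_zero (b + dir j) k' (j + 2)]
      exact ih.trans hj
  exact ((joinedIn_testIn_center hδ hη h4 hd₀ N x k).trans hcent).trans
    (joinedIn_testIn_center hδ hη h4 hd₀ N y k').symm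

/-! ### Outside: from the outer test point through the exterior squares -/

omit hδ hη h4 hd₀ in
/-- The centre of the unit square `g`, in the frame of any of its corners. [folklore] -/
theorem center_frame (g : Site 2) (j : Fin 4) :
    framePt δ (corner g j, j) (δ / 2) (δ / 2) = framePt δ (g, 0) (δ / 2) (δ / 2) := by
  fin_cases j <;> apply Complex.ext <;>
    simp [framePt, corner, meshPoint, Site.toComplex, dir, Pi.add_apply] <;> ring

omit hδ hη h4 hd₀ in
/-- The centre of the square across the `j`-th side of `g`, in the frame of the `j`-th corner of `g`. [folklore] -/
theorem center_across_frame (g : Site 2) (j : Fin 4) :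
    framePt δ (corner g j, j) (δ / 2) (-(δ / 2)) = framePt δ (g + dir (j + 3), 0) (δ / 2) (δ / 2) := by
  fin_cases j <;> apply Complex.ext <;>
    simp [framePt, corner, meshPoint, Site.toComplex, dir, Pi.add_apply] <;> ring

omit hd₀ in
/-- The centre of a unit square is no connector point. [folklore] -/
theorem center_not_conn {x : Site 2} {k : Fin 4} {e : Site 2 × Fin 4} (he : aedge e ∈ E) {t₀ : ℝ}
    (ht₀ : t₀ ∈ Icc η (δ - η))
    (hz : framePt δ (x, k) (δ / 2) (δ / 2) = framePt δ e t₀ η ∨ framePt δ (x, k) (δ / 2) (δ / 2) = framePt δ e t₀ (-η)) :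
    False := by
  have ha : |δ / 2| < δ - η := by rw [abs_of_pos (by positivity)]; linarith
  obtain ⟨K, t, σ, ht, hσ, -, h | h | h | h⟩ := conn_frame hδ hη ha ha he ht₀ hz <;> obtain ⟨-, h1, h2⟩ := h <;>
    rcases (abs_eq hη.le).1 hσ with rfl | rfl <;> linarith

/-- **Outside**: across a side not in `E`, the centres of the two adjacent squares are joined off the
polygon. [folklore] -/
theorem joinedIn_centers_across {v : Site 2} {K : Fin 4} (hne : aedge (v, K) ∉ E) :
    JoinedIn (range (arcPath E δ η d₀ N))ᶜ (framePt δ (v, K) (δ / 2) (δ / 2)) (framePt δ (v, K) (δ / 2) (-(δ / 2))) := by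
  refine JoinedIn.of_segment_subset fun z hz hzΓ => ?_
  rw [segment_symm] at hz
  obtain ⟨c, hc, rfl⟩ := exists_of_mem_segment_snd (by linarith) hz
  have hc' : |c| ≤ δ / 2 := abs_le.2 ⟨by linarith [hc.1], hc.2⟩
  rcases side_or_conn_of_mem_range hη (by linarith) hd₀ N hzΓ with ⟨w, K', -, h⟩ | ⟨a, ha', t, ht, h⟩
  · exact centerLine_not_side hδ hη h4 hc' h
  · exact centerLine_not_conn hδ hη h4 hne hc' ha' ht h

/-- **Outside**: from the outer test point of an external dart to the centre of its exterior square, off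
the polygon. [folklore] -/
theorem joinedIn_testOut_center {x : Site 2} {k : Fin 4} (hne : aedge (x, k) ∉ E) :
    JoinedIn (range (arcPath E δ η d₀ N))ᶜ (framePt δ (x, k) (η + η / 4) (η / 2)) (framePt δ (x, k) (δ / 2) (δ / 2)) := by
  have h1 : JoinedIn (range (arcPath E δ η d₀ N))ᶜ (framePt δ (x, k) (η + η / 4) (η / 2))
      (framePt δ (x, k) (δ / 2) (η / 2)) := by
    refine JoinedIn.of_segment_subset fun z hz hzΓ => ?_
    obtain ⟨s, hs, rfl⟩ := exists_of_mem_segment_fst (by linarith) hz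
    have hs' : s ∈ Ioc η (δ / 2) := ⟨by linarith [hs.1], hs.2⟩
    have hc : η / 2 ∈ Ioo 0 η := ⟨by positivity, by linarith⟩
    rcases side_or_conn_of_mem_range hη (by linarith) hd₀ N hzΓ with ⟨w, K', -, h⟩ | ⟨a, ha', t, ht, h⟩
    · exact approach_not_side hδ hη h4 hs' hc h
    · exact approach_not_conn hδ hη h4 hs' hc ha' ht h
  have h2 : JoinedIn (range (arcPath E δ η d₀ N))ᶜ (framePt δ (x, k) (δ / 2) (η / 2))
      (framePt δ (x, k) (δ / 2) (δ / 2)) := by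
    refine JoinedIn.of_segment_subset fun z hz hzΓ => ?_
    obtain ⟨c, hc, rfl⟩ := exists_of_mem_segment_snd (by linarith) hz
    have hc' : |c| ≤ δ / 2 := abs_le.2 ⟨by linarith [hc.1], hc.2⟩
    rcases side_or_conn_of_mem_range hη (by linarith) hd₀ N hzΓ with ⟨w, K', -, h⟩ | ⟨a, ha', t, ht, h⟩
    · exact centerLine_not_side hδ hη h4 hc' h
    · exact centerLine_not_conn hδ hη h4 hne hc' ha' ht h
  exact h1.trans h2

/-- **Outside**: along an escape chain of exterior squares the centres are joined off the polygon. [folklore] -/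
theorem joinedIn_of_chain {p : ℂ} {g g' : Site 2}
    (hg : JoinedIn (range (arcPath E δ η d₀ N))ᶜ p (framePt δ (g, 0) (δ / 2) (δ / 2)))
    (hchain : Relation.ReflTransGen
      (fun a b : Site 2 => ∃ j : Fin 4, b = a + dir (j + 3) ∧ s(corner a j, corner a j + dir j) ∉ E) g g') :
    JoinedIn (range (arcPath E δ η d₀ N))ᶜ p (framePt δ (g', 0) (δ / 2) (δ / 2)) := by
  induction hchain with
  | refl => exact hg
  | @tail b c _ hbc ih =>
    obtain ⟨j, rfl, hj⟩ := hbc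
    have h := joinedIn_centers_across hδ hη h4 hd₀ N (v := corner b j) (K := j) hj
    rw [center_frame, center_across_frame] at h
    exact ih.trans h

omit hδ hη h4 hd₀ in
/-- A point of a segment is at least as high as the lower endpoint (private copy of
`FreeArcPhase.im_ge_of_mem_segment`, not imported to keep this file light). [folklore] -/
private theorem le_im_of_mem_segment {u v z : ℂ} {Y : ℝ} (hu : Y ≤ u.im) (hv : Y ≤ v.im) (hz : z ∈ segment ℝ u v) :
    Y ≤ z.im := by
  rw [segment_eq_image_lineMap] at hz
  obtain ⟨θ, ⟨h0, h1⟩, rfl⟩ := hz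
  rw [AffineMap.lineMap_apply_module]
  simp only [add_im, smul_im, smul_eq_mul]
  nlinarith

/-- **Polygon points are not high**: every point of the polygon has height `≤ δ (Y + 1)` if all vertices have
second coordinate `≤ Y`. [folklore] -/
theorem im_le_of_mem_range {Y : ℤ} (hY : ∀ w ∈ verts E, w 1 ≤ Y) {z : ℂ} (hz : z ∈ range (arcPath E δ η d₀ N)) :
    z.im ≤ δ * (Y + 1) := by
  have key : ∀ w ∈ verts E, |z.im - δ * w 1| ≤ δ → z.im ≤ δ * (Y + 1) := by
    intro w hw h
    have h1 := (abs_le.1 h).2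
    have h2 : (w 1 : ℝ) ≤ Y := by exact_mod_cast hY w hw
    nlinarith
  rcases side_or_conn_of_mem_range hη (by linarith) hd₀ N hz with ⟨w, K', hext, h⟩ | ⟨a, ha', t, ht, h⟩
  · obtain ⟨w', hw', -, h2⟩ := near_verts_of_side hη hext h
    exact key w' hw' (h2.trans (by linarith))
  · obtain ⟨w', hw', -, h2⟩ := near_verts_of_conn hη ha' ht h
    exact key w' hw' h2

/-- **Far above, everything is joined off the polygon.** [folklore] -/
theorem joinedIn_far {Y : ℤ} (hY : ∀ w ∈ verts E, w 1 ≤ Y) {p q : ℂ} (hp : δ * (Y + 1) < p.im)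
    (hq : δ * (Y + 1) < q.im) : JoinedIn (range (arcPath E δ η d₀ N))ᶜ p q := by
  set H : ℝ := max p.im q.im with hH
  have seg : ∀ {u v : ℂ}, δ * (Y + 1) < u.im → δ * (Y + 1) < v.im →
      JoinedIn (range (arcPath E δ η d₀ N))ᶜ u v ∨ True → segment ℝ u v ⊆ (range (arcPath E δ η d₀ N))ᶜ := by
    intro u v hu hv _ z hz hzΓ
    have h1 := le_im_of_mem_segment (min_le_left u.im v.im) (min_le_right u.im v.im) hz
    have h2 := im_le_of_mem_range hδ hη h4 hd₀ N hY hzΓ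
    have h3 : δ * (Y + 1) < min u.im v.im := lt_min hu hv
    linarith
  have hp' : δ * (Y + 1) < (⟨p.re, H⟩ : ℂ).im := hp.trans_le (le_max_left _ _)
  have hq' : δ * (Y + 1) < (⟨q.re, H⟩ : ℂ).im := hq.trans_le (le_max_right _ _)
  exact ((JoinedIn.of_segment_subset (seg hp hp' (Or.inr trivial))).trans
    (JoinedIn.of_segment_subset (seg hp' hq' (Or.inr trivial)))).trans
    (JoinedIn.of_segment_subset (seg hq' hq (Or.inr trivial)))

/-! ### The theorem -/

omit hδ hη h4 hd₀ in
/-- Joined points lie in one connected component. [folklore] -/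
theorem mem_connectedComponentIn_of_joinedIn {F : Set ℂ} {p q : ℂ} (h : JoinedIn F p q) :
    q ∈ connectedComponentIn F p := by
  obtain ⟨γ, hγ⟩ := h
  have hsub : range γ ⊆ F := by rintro _ ⟨t, rfl⟩; exact hγ t
  exact (isPreconnected_range γ.continuous).subset_connectedComponentIn ⟨0, γ.source⟩ hsub ⟨1, γ.target⟩

end WindowRect

open WindowRect in
/-- **One boundary cycle.** For a connected, combinatorially hole-free finite set `E` of lattice edges, the
boundary-tracing orbit (`DiscreteRect.succ`) of an external dart `d₀`, of period `N`, passes through every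
external dart. See the module docstring for the proof. [folklore] -/
theorem exists_iterate_succ_eq_of_escape {E : Finset (Sym2 (Site 2))}
    (hE : ∀ e ∈ E, e ∈ (zdGraph 2).edgeSet)
    (hconn : ∀ x ∈ verts E, ∀ y ∈ verts E, Relation.ReflTransGen (fun a b : Site 2 => s(a, b) ∈ E) x y)
    (hesc : ∀ g : Site 2, (∃ j : Fin 4, s(corner g j, corner g j + dir j) ∉ E) → ∀ M : ℤ, ∃ g' : Site 2,
      M ≤ g' 1 ∧ Relation.ReflTransGen
        (fun a b : Site 2 => ∃ j : Fin 4, b = a + dir (j + 3) ∧ s(corner a j, corner a j + dir j) ∉ E) g g')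
    {d₀ : Site 2 × Fin 4} (hd₀ : IsExtDart E d₀) {N : ℕ} (hN0 : 0 < N) (hN : (succ E)^[N] d₀ = d₀)
    (hinj : ∀ i j, i < N → j < N → (succ E)^[i] d₀ = (succ E)^[j] d₀ → i = j)
    {d : Site 2 × Fin 4} (hd : IsExtDart E d) : ∃ j < N, (succ E)^[j] d₀ = d := by
  by_contra hcon
  push Not at hcon
  obtain ⟨x, k⟩ := d
  obtain ⟨x₀, k₀⟩ := d₀
  have hδ : (0 : ℝ) < 1 := one_pos
  have hη : (0 : ℝ) < 1 / 4 := by norm_num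
  have h4 : 4 * (1 / 4 : ℝ) ≤ 1 := by norm_num
  -- the loop and the constancy of winding numbers along paths off it
  have hcont : ContinuousOn (arcPath E 1 (1 / 4) (x₀, k₀) N).extend (Icc 0 1) :=
    (arcPath E 1 (1 / 4) (x₀, k₀) N).continuous_extend.continuousOn
  have h01 : (arcPath E 1 (1 / 4) (x₀, k₀) N).extend 0 = (arcPath E 1 (1 / 4) (x₀, k₀) N).extend 1 := by
    rw [Path.extend_zero, Path.extend_one, hN]
  have hK : IsClosed (range (arcPath E 1 (1 / 4) (x₀, k₀) N)) :=
    (isCompact_range (arcPath E 1 (1 / 4) (x₀, k₀) N).continuous).isClosed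
  have hmaps : MapsTo (arcPath E 1 (1 / 4) (x₀, k₀) N).extend (Icc 0 1) (range (arcPath E 1 (1 / 4) (x₀, k₀) N)) :=
    fun t ht => ⟨⟨t, ht⟩, (Path.extend_apply _ ht).symm⟩
  have const : ∀ {p q : ℂ}, JoinedIn (range (arcPath E 1 (1 / 4) (x₀, k₀) N))ᶜ p q →
      wind (fun t => (arcPath E 1 (1 / 4) (x₀, k₀) N).extend t - p) =
        wind (fun t => (arcPath E 1 (1 / 4) (x₀, k₀) N).extend t - q) := fun h =>
    wind_sub_eq_of_mem_connectedComponentIn hcont h01 hK hmaps (mem_connectedComponentIn_of_joinedIn h)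
  -- the jumps
  have w1 := wind_test_eq_add_one (δ := 1) (η := 1 / 4) hδ hη h4 hN hinj hN0 (x := x₀) (k := k₀) rfl
  have w2 := wind_test_eq (δ := 1) (η := 1 / 4) hδ hη h4 hN (x := x) (k := k) hcon
  -- inside
  have w3 := const (joinedIn_testIn hδ hη h4 hd₀ N hE k k₀ (hconn x hd.1 x₀ hd₀.1))
  -- outside
  obtain ⟨Y, hY⟩ : ∃ Y : ℤ, ∀ w ∈ verts E, w 1 ≤ Y := by
    obtain ⟨w₀, -, hw₀⟩ := (verts E).exists_max_image (fun w => w 1) ⟨x, hd.1⟩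
    exact ⟨w₀ 1, hw₀⟩
  obtain ⟨g, hg, hchain⟩ := hesc (quad x k) ⟨k, by rw [corner_quad]; exact hd.2⟩ (Y + 2)
  obtain ⟨g₀, hg₀, hchain₀⟩ := hesc (quad x₀ k₀) ⟨k₀, by rw [corner_quad]; exact hd₀.2⟩ (Y + 2)
  have hout : JoinedIn (range (arcPath E 1 (1 / 4) (x₀, k₀) N))ᶜ (framePt 1 (x, k) (1 / 4 + 1 / 4 / 4) (1 / 4 / 2))
      (framePt 1 (g, 0) (1 / 2) (1 / 2)) := by
    have h := joinedIn_testOut_center hδ hη h4 hd₀ N (x := x) (k := k) hd.2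
    rw [show framePt (1 : ℝ) (x, k) (1 / 2) (1 / 2) = framePt 1 (corner (quad x k) k, k) (1 / 2) (1 / 2) by
      rw [corner_quad], center_frame] at h
    exact joinedIn_of_chain hδ hη h4 hd₀ N h hchain
  have hout₀ : JoinedIn (range (arcPath E 1 (1 / 4) (x₀, k₀) N))ᶜ (framePt 1 (x₀, k₀) (1 / 4 + 1 / 4 / 4) (1 / 4 / 2))
      (framePt 1 (g₀, 0) (1 / 2) (1 / 2)) := by
    have h := joinedIn_testOut_center hδ hη h4 hd₀ N (x := x₀) (k := k₀) hd₀.2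
    rw [show framePt (1 : ℝ) (x₀, k₀) (1 / 2) (1 / 2) = framePt 1 (corner (quad x₀ k₀) k₀, k₀) (1 / 2) (1 / 2) by
      rw [corner_quad], center_frame] at h
    exact joinedIn_of_chain hδ hη h4 hd₀ N h hchain₀
  have hfar : JoinedIn (range (arcPath E 1 (1 / 4) (x₀, k₀) N))ᶜ (framePt 1 (g, 0) (1 / 2) (1 / 2)) (framePt 1 (g₀, 0) (1 / 2) (1 / 2)) := by
    refine joinedIn_far hδ hη h4 hd₀ N hY ?_ ?_
    · have : ((Y : ℝ) + 2) ≤ g 1 := by exact_mod_cast hg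
      simp only [framePt_im]; simp [dir]; linarith
    · have : ((Y : ℝ) + 2) ≤ g₀ 1 := by exact_mod_cast hg₀
      simp only [framePt_im]; simp [dir]; linarith
  have w4 := const ((hout.trans hfar).trans hout₀.symm)
  omega

/-- **One boundary cycle**, closed form (registered sub-goal of stmt-CriticalPhenomena-10650): the
boundary-tracing orbit of a connected, combinatorially hole-free finite edge set covers all external darts.
[folklore] -/
theorem windowRect_cover_of_escape : ∀ {E : Finset (Sym2 (Site 2))}, (∀ e ∈ E, e ∈ (zdGraph 2).edgeSet) → (∀ x ∈ DiscreteRect.verts E, ∀ y ∈ DiscreteRect.verts E, Relation.ReflTransGen (fun a b : Site 2 => s(a, b) ∈ E) x y) → (∀ g : Site 2, (∃ j : Fin 4, s(DiscreteRect.corner g j, DiscreteRect.corner g j + DiscreteRect.dir j) ∉ E) → ∀ M : ℤ, ∃ g' : Site 2, M ≤ g' 1 ∧ Relation.ReflTransGen (fun a b : Site 2 => ∃ j : Fin 4, b = a + DiscreteRect.dir (j + 3) ∧ s(DiscreteRect.corner a j, DiscreteRect.corner a j + DiscreteRect.dir j) ∉ E) g g') → ∀ {d₀ : Site 2 × Fin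 4}, DiscreteRect.IsExtDart E d₀ → ∀ {N : ℕ}, 0 < N → (DiscreteRect.succ E)^[N] d₀ = d₀ → (∀ i j, i < N → j < N → (DiscreteRect.succ E)^[i] d₀ = (DiscreteRect.succ E)^[j] d₀ → i = j) → ∀ {d : Site 2 × Fin 4}, DiscreteRect.IsExtDart E d → ∃ j < N, (DiscreteRect.succ E)^[j] d₀ = d :=
  fun hE hconn hesc _ hd₀ _ hN0 hN hinj _ hd => exists_iterate_succ_eq_of_escape hE hconn hesc hd₀ hN0 hN hinj hd

end Summit.CriticalPhenomena.SAWScalingLimit.Theorems.IsingBoundaryRatio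

end
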